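import Literature.Analysis.FluidPDE.SuitableWeak
import Literature.Analysis.FluidPDE.AxisymmetricEuler
import HarnessLib

/-!
# Lei–Ren's quantitative shells of regularity for suitable weak solutions (named fact, D-0014)

Topic `Literature/Analysis/FluidPDE` (cite item `wi-87109`; consumer: crux `AveragedConeLiouville`
= `stmt-NavierStokesRegularity-26889` of route `AxisTwistDoor`, line `lrt_shell`, whose hypothesis
stub `ShellFact` is the specialisation of this fact to the route's energy class).

Z. Lei, X. Ren, *Quantitative partial regularity of the Navier–Stokes equations and applications*,
Adv. Math. 445 (2024) 109654 (arXiv:2210.01783), prove quantitative INTERVALS (Thm. 2), ANNULI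
(Remark 8) and EPOCHS (Prop. 9) of regularity for every local suitable weak solution in the unit
parabolic cylinder, with lengths and bounds controlled only by the local `L³`/`L^{3/2}` energies.
Z. Lei, X. Ren, G. Tian, *A geometric characterization of potential Navier–Stokes singularities*
(arXiv:2501.08976), Lemma 2.4, combine them into the following statement, VERBATIM (p. 7):

> **Lemma 2.4 ([LR] Quantitative shells of regularity).** Let `v` be a suitable weak solution in
> `Q(1)` and denote `G = ∫_{Q(1)} (|v|³ + |p|^{3/2}) dx dt + 2 < +∞`. There exist numbers
> `a ∈ (2/3, 3/4)` and `δ ∈ (G^{−O(G)}, 1/10)` such that `v` is regular in the space-time closure of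
> `Q(a + δ) ∖ Q(a − δ)` with the estimates
> `sup_{Q(a+δ) ∖ Q(a−δ)} (|v| + |∇v| + |∇²v|) < G^{O(G)}`.
> Here, `O(G)` stands for a positive number bounded by `G` times a universal constant. […]
> Moreover, by simple modifications in the proof (see [LR]), one can replace `B(r), Q(r)` with
> `ℬ(r), 𝒬(r)` in the statement of Lemma 2.4.

with the notation of their §2 (p. 6): `B(r) = {|x| < r}`, `Q(r) = B(r) × (−r², 0)`,
`ℬ(r) = {|x_h| < r, |x₃| < r}`, `𝒬(r) = ℬ(r) × (−r², 0)`, and (§2.1) "a local suitable weak solution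
in `Q(1)`": finite local energies `sup_{−1<t<0} ∫_{B(1)} |v|² + ∫_{Q(1)} |∇v|² + ∫_{Q(1)} |p|^{3/2} < ∞`,
`(v, p)` solves Navier–Stokes (`ν = 1`, no force) in the sense of distributions, and the local
energy inequality holds for every nonnegative smooth `φ` compactly supported in `Q(1)`.

## The Lean statement (`leiRenTian_quantitative_shells_of_regularity`)

* Space–time is `ℝ × ℝ³`, time first (tree convention of `parabolicCylinder`), `ℝ³ =
  EuclideanSpace ℝ (Fin 3)`; both shapes are treated at once through a Boolean flag:
  `lrtBall false r = B(r)`, `lrtBall true r = ℬ(r)` (with the tree's `cylRadius x = |x_h|`),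
  `lrtCylinder cyl r = (−r², 0) × lrtBall cyl r`, and `lrtCylinder false r` IS the tree's
  `parabolicCylinder r (0, 0)` (`lrtCylinder_false`).
* "local suitable weak solution in `Q(1)`" = the tree's `IsSuitableWeakSolutionOn` (CKN/Lin:
  distributional solution, `L^∞L²`/`L^{3/2}`/`∇v ∈ L²` LOCALLY, local energy inequality) on
  `lrtCylinderOpens cyl 1` with `ν = 1`, `f = 0`, PLUS LRT's global-in-`Q(1)` finiteness of the
  three energies (stated with an explicit weak spatial gradient `H`) and of `∫_{Q(1)} |v|³` (which
  LRT note is automatic by interpolation; kept as an explicit hypothesis).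
* `G = lrtG cyl v p = (∫_{Q(1)} (|v|³ + |p|^{3/2})).toReal + 2` (a real number `≥ 2`).
* "`δ ∈ (G^{−O(G)}, 1/10)`" and "`< G^{O(G)}`" with ONE universal constant `C > 0`: since `G ≥ 2`,
  a positive exponent `M ≤ C·G` gives `G^{−M} ≥ G^{−CG}` and `G^{M} ≤ G^{CG}`, so the printed
  statement implies `G^{−CG} < δ < 1/10` and bounds `< G^{CG}`; this is what is recorded.
* "regular in the space-time closure of `Q(a+δ) ∖ Q(a−δ)` with `sup (|v| + |∇v| + |∇²v|) < G^{O(G)}`"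
  is recorded on the OPEN shell `lrtShell cyl a δ = Q(a+δ) ∖ closure Q(a−δ)` (a subset of the printed
  region; since `δ` ranges in an open interval nothing is lost): `v` agrees a.e. there with a field
  `w`, continuous on the shell, `C²` in space on every time slice, with
  `|w| + |∇w| + |∇²w| < G^{CG}` pointwise (Fréchet derivatives `fderiv`, `iteratedFDeriv ℝ 2`).

Nothing else of [LR]/[LRT] is vendored (no flux identities, no Liouville theorem). A named fact
(`def … : Prop`, D-0014); users take `(h : leiRenTian_quantitative_shells_of_regularity)`.

## References

* Z. Lei, X. Ren, G. Tian, arXiv:2501.08976, §2 (p. 6) and Lemma 2.4 (p. 7). [LeiRenTian2025]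
* Z. Lei, X. Ren, Adv. Math. 445 (2024) 109654, Thm. 2, Remark 8, Prop. 9 (§1.1, p. 5 of
  arXiv:2210.01783v3). [LeiRen2024QuantitativePartialRegularity]
-/

noncomputable section

open MeasureTheory Set Function Filter Topology TopologicalSpace
open scoped InnerProductSpace RealInnerProductSpace NNReal ENNReal

namespace Literature.Analysis.FluidPDE

/-! ### LRT's domains `B(r)`, `ℬ(r)`, `Q(r)`, `𝒬(r)` and the constant `G` -/

/-- LRT's space domains (§2, p. 6): the ball `B(r) = {x ∈ ℝ³ : |x| < r}` (`cyl = false`) and the flat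
cylinder `ℬ(r) = {x ∈ ℝ³ : |x_h| < r, |x₃| < r}` (`cyl = true`; `|x_h| = cylRadius x`).
[cite: LeiRenTian2025, §2 (p. 6)] -/
def lrtBall (cyl : Bool) (r : ℝ) : Set (EuclideanSpace ℝ (Fin 3)) :=
  if cyl then {x | cylRadius x < r ∧ |x 2| < r} else Metric.ball 0 r

/-- LRT's parabolic cylinders (§2, p. 6): `Q(r) = B(r) × (−r², 0)` (`cyl = false`) and
`𝒬(r) = ℬ(r) × (−r², 0)` (`cyl = true`), as subsets of space–time `ℝ × ℝ³` with the time coordinate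
FIRST (the tree's convention, cf. `parabolicCylinder`). [cite: LeiRenTian2025, §2 (p. 6)] -/
def lrtCylinder (cyl : Bool) (r : ℝ) : Set (ℝ × EuclideanSpace ℝ (Fin 3)) :=
  Ioo (-r ^ 2) 0 ×ˢ lrtBall cyl r

/-- Unfolding `lrtBall false`: the ball. [cite: LeiRenTian2025, §2 (p. 6)] -/
@[simp]
theorem lrtBall_false (r : ℝ) : lrtBall false r = Metric.ball 0 r :=
  rfl

/-- Unfolding `lrtBall true`: the flat cylinder `{|x_h| < r, |x₃| < r}`. [cite: LeiRenTian2025, §2 (p. 6)] -/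
@[simp]
theorem lrtBall_true (r : ℝ) :
    lrtBall true r = {x : EuclideanSpace ℝ (Fin 3) | cylRadius x < r ∧ |x 2| < r} :=
  rfl

/-- Membership in `lrtCylinder`. [cite: LeiRenTian2025, §2 (p. 6)] -/
theorem mem_lrtCylinder_iff (cyl : Bool) (r : ℝ) (z : ℝ × EuclideanSpace ℝ (Fin 3)) :
    z ∈ lrtCylinder cyl r ↔ (-r ^ 2 < z.1 ∧ z.1 < 0) ∧ z.2 ∈ lrtBall cyl r := by
  simp [lrtCylinder, mem_prod]

/-- `Q(r)` of LRT is the tree's backward parabolic cylinder `parabolicCylinder r (0, 0)` centred at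
the space–time origin. [cite: LeiRenTian2025, §2 (p. 6)] -/
theorem lrtCylinder_false (r : ℝ) :
    lrtCylinder false r = parabolicCylinder r ((0 : ℝ), (0 : EuclideanSpace ℝ (Fin 3))) := by
  ext z
  simp [lrtCylinder, parabolicCylinder, mem_prod]

/-- The space domains are open. [cite: LeiRenTian2025, §2 (p. 6)] -/
theorem isOpen_lrtBall (cyl : Bool) (r : ℝ) : IsOpen (lrtBall cyl r) := by
  cases cyl
  · simp [Metric.isOpen_ball]
  · simp only [lrtBall_true]
    refine IsOpen.inter (isOpen_lt continuous_cylRadius continuous_const) ?_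
    exact isOpen_lt (continuous_abs.comp (EuclideanSpace.proj (2 : Fin 3)).continuous)
      continuous_const

/-- The parabolic cylinders are open. [cite: LeiRenTian2025, §2 (p. 6)] -/
theorem isOpen_lrtCylinder (cyl : Bool) (r : ℝ) : IsOpen (lrtCylinder cyl r) :=
  isOpen_Ioo.prod (isOpen_lrtBall cyl r)

/-- `Q(r)` / `𝒬(r)` as an open subset of space–time (a domain for `IsSuitableWeakSolutionOn`).
[cite: LeiRenTian2025, §2 (p. 6)] -/
def lrtCylinderOpens (cyl : Bool) (r : ℝ) : Opens (ℝ × EuclideanSpace ℝ (Fin 3)) :=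
  ⟨lrtCylinder cyl r, isOpen_lrtCylinder cyl r⟩

/-- Unfolding `lrtCylinderOpens`. [cite: LeiRenTian2025, §2 (p. 6)] -/
@[simp]
theorem coe_lrtCylinderOpens (cyl : Bool) (r : ℝ) :
    ((lrtCylinderOpens cyl r : Opens (ℝ × EuclideanSpace ℝ (Fin 3))) :
      Set (ℝ × EuclideanSpace ℝ (Fin 3))) = lrtCylinder cyl r :=
  rfl

/-- **LRT's constant `G = G[v, p] := ∫_{Q(1)} (|v|³ + |p|^{3/2}) dx dt + 2`** (§2.1, p. 6: "The constant
`2` in the definition of `G` is added to make the statement of Lemma 2.4 below more convenient"),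
as a real number (the `toReal` of the extended integral; junk `2` when the integral is infinite —
the fact below assumes it finite). [cite: LeiRenTian2025, §2.1 (p. 6)] -/
def lrtG (cyl : Bool) (v : ℝ → EuclideanSpace ℝ (Fin 3) → EuclideanSpace ℝ (Fin 3))
    (p : ℝ → EuclideanSpace ℝ (Fin 3) → ℝ) : ℝ :=
  (∫⁻ z in lrtCylinder cyl 1,
      (‖v z.1 z.2‖ₑ ^ (3 : ℝ) + ‖p z.1 z.2‖ₑ ^ (3 / 2 : ℝ))).toReal + 2

/-- `G ≥ 2` (in particular `G > 1`, so that `G^{−CG} < G^{CG}`). [cite: LeiRenTian2025, §2.1 (p. 6)] -/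
theorem two_le_lrtG (cyl : Bool) (v : ℝ → EuclideanSpace ℝ (Fin 3) → EuclideanSpace ℝ (Fin 3))
    (p : ℝ → EuclideanSpace ℝ (Fin 3) → ℝ) : 2 ≤ lrtG cyl v p := by
  have := ENNReal.toReal_nonneg
    (a := ∫⁻ z in lrtCylinder cyl 1, (‖v z.1 z.2‖ₑ ^ (3 : ℝ) + ‖p z.1 z.2‖ₑ ^ (3 / 2 : ℝ)))
  unfold lrtG
  linarith

/-- **The open regular shell `Q(a+δ) ∖ cl Q(a−δ)`** (resp. `𝒬(a+δ) ∖ cl 𝒬(a−δ)`), on which Lemma 2.4's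
bounds are recorded (a subset of the printed "space-time closure of `Q(a+δ) ∖ Q(a−δ)`").
[cite: LeiRenTian2025, Lemma 2.4 (p. 7)] -/
def lrtShell (cyl : Bool) (a δ : ℝ) : Set (ℝ × EuclideanSpace ℝ (Fin 3)) :=
  lrtCylinder cyl (a + δ) \ closure (lrtCylinder cyl (a - δ))

/-- The regular shell is open. [cite: LeiRenTian2025, Lemma 2.4 (p. 7)] -/
theorem isOpen_lrtShell (cyl : Bool) (a δ : ℝ) : IsOpen (lrtShell cyl a δ) :=
  (isOpen_lrtCylinder cyl _).sdiff isClosed_closure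

/-- The regular shell lies in the big cylinder `Q(a+δ)`. [cite: LeiRenTian2025, Lemma 2.4 (p. 7)] -/
theorem lrtShell_subset (cyl : Bool) (a δ : ℝ) : lrtShell cyl a δ ⊆ lrtCylinder cyl (a + δ) :=
  Set.sdiff_subset

/-- The closure of `𝒬(r)` lies in the closed flat cylinder `[−r², 0] × {|x_h| ≤ r, |x₃| ≤ r}`.
[cite: LeiRenTian2025, §2 (p. 6)] -/
theorem closure_lrtCylinder_true_subset (r : ℝ) :
    closure (lrtCylinder true r) ⊆
      Icc (-r ^ 2) 0 ×ˢ {x : EuclideanSpace ℝ (Fin 3) | cylRadius x ≤ r ∧ |x 2| ≤ r} := by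
  refine (closure_mono (s := lrtCylinder true r)
    (t := Icc (-r ^ 2) 0 ×ˢ {x : EuclideanSpace ℝ (Fin 3) | cylRadius x ≤ r ∧ |x 2| ≤ r}) ?_).trans
    (subset_of_eq ?_)
  · rintro ⟨t, x⟩ h
    rw [mem_lrtCylinder_iff, lrtBall_true] at h
    exact ⟨⟨h.1.1.le, h.1.2.le⟩, h.2.1.le, h.2.2.le⟩
  · refine IsClosed.closure_eq (isClosed_Icc.prod ?_)
    exact (isClosed_le continuous_cylRadius continuous_const).inter
      (isClosed_le (continuous_abs.comp (EuclideanSpace.proj (2 : Fin 3)).continuous) continuous_const)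

/-- **The lateral cylindrical shell lies in the regular shell**: a space–time point `(t, x)` with
`−(a+δ)² < t < 0`, `a − δ < |x_h| < a + δ` and `|x₃| < a + δ` belongs to `𝒬(a+δ) ∖ cl 𝒬(a−δ)` (the
region consumed by the route's `ShellFact`). [cite: LeiRenTian2025, Lemma 2.4 (p. 7)] -/
theorem mem_lrtShell_true_of_lateral {a δ t : ℝ} {x : EuclideanSpace ℝ (Fin 3)}
    (ht : -(a + δ) ^ 2 < t) (ht0 : t < 0) (hr : a - δ < cylRadius x) (hr' : cylRadius x < a + δ)
    (hz : |x 2| < a + δ) : (t, x) ∈ lrtShell true a δ := by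
  refine ⟨?_, fun hmem => ?_⟩
  · rw [mem_lrtCylinder_iff, lrtBall_true]
    exact ⟨⟨ht, ht0⟩, hr', hz⟩
  · have h := closure_lrtCylinder_true_subset (a - δ) hmem
    exact absurd h.2.1 (not_le.2 hr)

/-! ### The named fact -/

/-- **Lei–Ren's quantitative shells of regularity** (Lei–Ren–Tian, arXiv:2501.08976, Lemma 2.4,
quoting Lei–Ren, Adv. Math. 445 (2024), Thm. 2 / Remark 8 / Prop. 9), VERBATIM: "Let `v` be a
suitable weak solution in `Q(1)` and denote `G = ∫_{Q(1)} (|v|³ + |p|^{3/2}) dx dt + 2 < +∞`. There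
exist numbers `a ∈ (2/3, 3/4)` and `δ ∈ (G^{−O(G)}, 1/10)` such that `v` is regular in the space-time
closure of `Q(a+δ) ∖ Q(a−δ)` with the estimates `sup_{Q(a+δ)∖Q(a−δ)} (|v| + |∇v| + |∇²v|) < G^{O(G)}`.
Here, `O(G)` stands for a positive number bounded by `G` times a universal constant. […] one can
replace `B(r), Q(r)` with `ℬ(r), 𝒬(r)` in the statement of Lemma 2.4."
Recorded (see the module docstring for the dictionary): there is a universal `C > 0` such that for
both shapes (`cyl = false`: balls `Q`; `cyl = true`: flat cylinders `𝒬`) and every local suitable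
weak solution `(v, p)` of Navier–Stokes (`ν = 1`, no force) in the unit cylinder — the tree's
`IsSuitableWeakSolutionOn` on `lrtCylinderOpens cyl 1` together with LRT §2.1's finite energies on the
whole of `Q(1)` (`sup_t ∫_{B(1)}|v|²`, `∫_{Q(1)}|∇v|²` for a weak spatial gradient `H`, `∫_{Q(1)}|p|^{3/2}`)
and `∫_{Q(1)} |v|³ < ∞` — there are `a ∈ (2/3, 3/4)` and `δ` with `G^{−CG} < δ < 1/10`, `G = lrtG cyl v p`,
and a representative `w` of `v` on the open shell `lrtShell cyl a δ = Q(a+δ) ∖ cl Q(a−δ)` (`v = w` a.e.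
there), continuous on the shell and `C²` in space on each time slice, with
`|w| + |∇w| + |∇²w| < G^{CG}` at every point of the shell. A named fact (D-0014); nothing is proved
here. [cite: LeiRenTian2025, Lemma 2.4 (p. 7)] [cite: LeiRen2024QuantitativePartialRegularity, Thm. 2, Remark 8 and Prop. 9 (§1.1)] -/
def leiRenTian_quantitative_shells_of_regularity : Prop :=
  ∃ C : ℝ, 0 < C ∧
    ∀ (cyl : Bool) (v : ℝ → EuclideanSpace ℝ (Fin 3) → EuclideanSpace ℝ (Fin 3))
      (p : ℝ → EuclideanSpace ℝ (Fin 3) → ℝ)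
      (H : ℝ → EuclideanSpace ℝ (Fin 3) → EuclideanSpace ℝ (Fin 3) →L[ℝ] EuclideanSpace ℝ (Fin 3)),
      IsSuitableWeakSolutionOn (lrtCylinderOpens cyl 1) 1 0 v p →
      HasWeakSpatialGradientOn (lrtCylinderOpens cyl 1) v H →
      (∃ M : ℝ≥0, ∀ᵐ t : ℝ, t ∈ Ioo (-1 : ℝ) 0 →
        ∫⁻ x in lrtBall cyl 1, ‖v t x‖ₑ ^ 2 ≤ M) →
      ∫⁻ z in lrtCylinder cyl 1, ENNReal.ofReal (frobeniusNormSq (H z.1 z.2)) < ∞ →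
      ∫⁻ z in lrtCylinder cyl 1, ‖p z.1 z.2‖ₑ ^ (3 / 2 : ℝ) < ∞ →
      ∫⁻ z in lrtCylinder cyl 1, ‖v z.1 z.2‖ₑ ^ (3 : ℝ) < ∞ →
      ∃ a δ : ℝ, 2 / 3 < a ∧ a < 3 / 4 ∧
        lrtG cyl v p ^ (-(C * lrtG cyl v p)) < δ ∧ δ < 1 / 10 ∧
        ∃ w : ℝ → EuclideanSpace ℝ (Fin 3) → EuclideanSpace ℝ (Fin 3),
          (uncurry v =ᵐ[volume.restrict (lrtShell cyl a δ)] uncurry w) ∧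
          ContinuousOn (uncurry w) (lrtShell cyl a δ) ∧
          (∀ t : ℝ, ContDiffOn ℝ 2 (w t) {x | (t, x) ∈ lrtShell cyl a δ}) ∧
          ∀ z ∈ lrtShell cyl a δ,
            ‖w z.1 z.2‖ + ‖fderiv ℝ (w z.1) z.2‖ + ‖iteratedFDeriv ℝ 2 (w z.1) z.2‖ <
              lrtG cyl v p ^ (C * lrtG cyl v p)

end Literature.Analysis.FluidPDE

end
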